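import Literature.Computability.QuantumComplexity.OracleRetarget
import Literature.Computability.QuantumComplexity.WireConjugation
import Literature.Computability.QuantumComplexity.HybridArgument
import HarnessLib

/-!
# Several re-targeted circuits on disjoint blocks sharing one classical prefix: branchwise product semantics

Topic `Literature/Computability/QuantumComplexity`; sequel of `OracleRetarget.lean` (one re-targeted circuit: on the
branch where the prefix wires read `c` it acts as the original circuit relative to the slice `A⟨c⟩`, placed along its
embedding) and `CircuitEmbedding.lean` (independent circuits on pairwise disjoint blocks map product states to product
states; Born weights of a product state form a product distribution). A JUXTAPOSITION of circuits `pre t`, `t < m`, each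
re-targeted to the SAME prefix register `p` but transported to its own block `E t` (blocks pairwise disjoint and disjoint
from `p`), acts on the branch `{prefix = c}` as the juxtaposition of the transported originals relative to `A⟨c⟩`; on a
basis input it therefore produces the product of the blocks' output states, and the probability of an event read on ONE
block is that block's own output probability (Nielsen–Chuang 2010, §2.2.8) — e.g. the query magnitude of a truncated run
(`HybridArgument.queryWeight`). This is the semantic core of "one copy = one truncated run per oracle gate" estimators.

* `keyDiagonal_flatMap_retarget` — the juxtaposition keeps the prefix wires classical;
* **`toMatrix_flatMap_retarget_mulVec`** — on branch-supported vectors it acts as the `flatMap` of the transported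
  (`mapWires`) circuits relative to `prefixSlice A (ofFn c)`;
* **`toMatrix_flatMap_retarget_mulVec_basisState`** — on a basis input `|w⟩` with prefix content `c` the output is the
  product state `prodState E (fun t => U_t^{A⟨c⟩} |w ∘ E t⟩) w`;
* **`sum_normSq_prodState_block_event`** — the Born weight of an event read on block `t` of a product of UNIT block
  states is the Born weight of block `t`'s state alone;
* **`sum_normSq_flatMap_retarget_block_event`** — assembled: the probability that block `t` shows an event `T` after the
  juxtaposed re-targeted circuits run on `|w⟩` (prefix `c`) is `Σ_{u : T u} |(U_t^{A⟨c⟩} |w ∘ E t⟩)(u)|²`.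

Everything here is PROVED; no definition, no named fact.

## References

* M. A. Nielsen, I. L. Chuang, *Quantum Computation and Quantum Information*, CUP 2010, §2.1.7 (tensor products),
  §2.2.8 (measurement statistics of product states), §4.3 [NielsenChuang2010].
* C. H. Bennett, E. Bernstein, G. Brassard, U. Vazirani, SIAM J. Comput. 26 (1997), §4 (independent subroutine calls),
  Def. 3.2 (query magnitude) [BennettBernsteinBrassardVazirani1997].
-/

noncomputable section

namespace Literature.Computability.QuantumComplexity

open Cryptography Matrix Finset

variable {G : QGateSet} {N₀ N P m : ℕ}
  (p : Fin P ↪ Fin N) (E : Fin m → (Fin N₀ ↪ Fin N)) (hdisj : ∀ t a i, p a ≠ E t i)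

/-! ### The juxtaposition keeps the prefix classical -/

/-- A `flatMap` of re-targeted circuits keeps the prefix wires classical. [cite: NielsenChuang2010, §4.4] -/
theorem keyDiagonal_flatMap_retarget (A : Language Bool) (pre : Fin m → List (QGate G N₀)) (l : List (Fin m)) :
    KeyDiagonal p ((⟨l.flatMap fun t => retarget p (E t) (hdisj t) (pre t)⟩ : QCircuit G N).toMatrix A) :=
  KeyDiagonal.circuit A _ fun g hg => by
    obtain ⟨t, -, hgt⟩ := List.mem_flatMap.1 hg
    obtain ⟨g₀, -, rfl⟩ := List.mem_map.1 hgt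
    exact keyDiagonal_retargetGate p (E t) (hdisj t) A g₀

/-! ### Branchwise semantics of the juxtaposition -/

include hdisj in
/-- A `flatMap` of transported circuits keeps every branch of the prefix (it sits off the prefix wires).
[cite: NielsenChuang2010, §4.3] -/
theorem flatMap_mapWires_mulVec_supported (B : Language Bool) (c : QReg P) (pre : Fin m → List (QGate G N₀)) :
    ∀ (l : List (Fin m)) {v : QReg N → ℂ}, (∀ z, z ∘ p ≠ c → v z = 0) →
      ∀ z, z ∘ p ≠ c →
        ((⟨l.flatMap fun t => (pre t).map (mapWiresGate (E t))⟩ : QCircuit G N).toMatrix B *ᵥ v) z = 0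
  | [], v, hv => by simpa using hv
  | t :: l, v, hv => by
    intro z hz
    have hK : KeyDiagonal p ((⟨(t :: l).flatMap fun t => (pre t).map (mapWiresGate (E t))⟩ : QCircuit G N).toMatrix B) :=
      KeyDiagonal.circuit B _ fun g hg => by
        obtain ⟨t', -, hgt⟩ := List.mem_flatMap.1 hg
        obtain ⟨g₀, -, rfl⟩ := List.mem_map.1 hgt
        rw [toMatrix_mapWiresGate]
        exact KeyDiagonal.placeGate_of_forall_ne (E t') _ fun i a h' => hdisj t' a i h'.symm
    exact KeyDiagonal.mulVec_eq_zero_of_supported hK hv hz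

/-- **Branchwise semantics of the juxtaposition.** On vectors supported on the branch `{z | z ∘ p = c}`, the `flatMap`
of the re-targeted circuits relative to `A` acts as the `flatMap` of the transported original circuits relative to the
slice `prefixSlice A (List.ofFn c)`. [cite: BennettBernsteinBrassardVazirani1997, §4] [cite: NielsenChuang2010, §6.1.1] -/
theorem toMatrix_flatMap_retarget_mulVec (A : Language Bool) (c : QReg P) (pre : Fin m → List (QGate G N₀)) :
    ∀ (l : List (Fin m)) {v : QReg N → ℂ}, (∀ z, z ∘ p ≠ c → v z = 0) →
      (⟨l.flatMap fun t => retarget p (E t) (hdisj t) (pre t)⟩ : QCircuit G N).toMatrix A *ᵥ v =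
        (⟨l.flatMap fun t => (pre t).map (mapWiresGate (E t))⟩ : QCircuit G N).toMatrix
          (prefixSlice A (List.ofFn c)) *ᵥ v
  | [], v, _ => by simp
  | t :: l, v, hv => by
    rw [List.flatMap_cons, List.flatMap_cons]
    have e1 : (⟨retarget p (E t) (hdisj t) (pre t) ++ l.flatMap fun t => retarget p (E t) (hdisj t) (pre t)⟩ :
        QCircuit G N) = (⟨retarget p (E t) (hdisj t) (pre t)⟩ : QCircuit G N).append
          ⟨l.flatMap fun t => retarget p (E t) (hdisj t) (pre t)⟩ := rfl
    have e2 : (⟨(pre t).map (mapWiresGate (E t)) ++ l.flatMap fun t => (pre t).map (mapWiresGate (E t))⟩ :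
        QCircuit G N) = (⟨(pre t).map (mapWiresGate (E t))⟩ : QCircuit G N).append
          ⟨l.flatMap fun t => (pre t).map (mapWiresGate (E t))⟩ := rfl
    rw [e1, e2, QCircuit.toMatrix_append, QCircuit.toMatrix_append, ← Matrix.mulVec_mulVec, ← Matrix.mulVec_mulVec,
      toMatrix_retarget_mulVec p (E t) (hdisj t) A c (pre t) hv]
    -- the first block's output stays on the branch (relative to the slice it is a transported circuit)
    have hv' : ∀ z, z ∘ p ≠ c →
        ((⟨(pre t).map (mapWiresGate (E t))⟩ : QCircuit G N).toMatrix (prefixSlice A (List.ofFn c)) *ᵥ v) z = 0 := by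
      have h := flatMap_mapWires_mulVec_supported p E hdisj (prefixSlice A (List.ofFn c)) c pre [t] hv
      simpa using h
    exact toMatrix_flatMap_retarget_mulVec A c pre l hv'

/-- **On a basis input the juxtaposition produces a product state**: for `w` with prefix content `c` and pairwise
disjoint blocks, running all re-targeted circuits (in the order of `Fin m`) yields
`prodState E (fun t => U_t^{A⟨c⟩} |w ∘ E t⟩) w`. [cite: NielsenChuang2010, §2.1.7 eq. (2.45)] -/
theorem toMatrix_flatMap_retarget_mulVec_basisState (A : Language Bool) (hE : BlockDisjoint E)
    (pre : Fin m → List (QGate G N₀)) (w : QReg N) :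
    (⟨(List.finRange m).flatMap fun t => retarget p (E t) (hdisj t) (pre t)⟩ : QCircuit G N).toMatrix A *ᵥ
        basisState w =
      prodState E (fun t => (⟨pre t⟩ : QCircuit G N₀).toMatrix (prefixSlice A (List.ofFn (w ∘ p))) *ᵥ
        basisState (w ∘ E t)) w := by
  have hv : ∀ z : QReg N, z ∘ p ≠ w ∘ p → basisState w z = 0 := fun z hz => by
    rw [basisState_apply, if_neg]
    rintro rfl
    exact hz rfl
  rw [toMatrix_flatMap_retarget_mulVec p E hdisj A (w ∘ p) pre (List.finRange m) hv,
    basisState_eq_prodState E w]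
  have h := toMatrix_flatMap_mapWires_mulVec_prodState (prefixSlice A (List.ofFn (w ∘ p))) hE
    (fun t => (⟨pre t⟩ : QCircuit G N₀)) (fun t => basisState (w ∘ E t)) w
  have e : ((List.finRange m).flatMap fun t => (pre t).map (mapWiresGate (E t))) =
      (List.finRange m).flatMap fun t => (mapWires (E t) (⟨pre t⟩ : QCircuit G N₀)).gates := by
    simp [mapWires]
  rw [e, h]

/-! ### Reading one block of a product state -/

/-- **An event read on one block of a product of unit block states has that block's own Born weight.**
[cite: NielsenChuang2010, §2.2.8 (measurement of one register of a product state)] -/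
theorem sum_normSq_prodState_block_event (hE : BlockDisjoint E) (φ : Fin m → QReg N₀ → ℂ)
    (hφ : ∀ t, normSq (φ t) = 1) (c : QReg N) (t : Fin m) (T : QReg N₀ → Prop) [DecidablePred T] :
    (∑ z : QReg N, if T (z ∘ E t) then ‖prodState E φ c z‖ ^ 2 else 0) =
      ∑ u : QReg N₀, if T u then ‖φ t u‖ ^ 2 else 0 := by
  classical
  have h1 : (∑ z : QReg N, if T (z ∘ E t) then ‖prodState E φ c z‖ ^ 2 else 0) =
      ∑ z : QReg N, ‖prodState E φ c z‖ ^ 2 * (fun y : Fin m → QReg N₀ => if T (y t) then (1 : ℝ) else 0)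
        (fun i => z ∘ E i) := by
    refine Finset.sum_congr rfl fun z _ => ?_
    simp only
    split_ifs <;> simp
  rw [h1, sum_normSq_prodState_mul hE φ c (fun y => if T (y t) then (1 : ℝ) else 0),
    sum_prod_mul_eq (fun i v => ‖φ i v‖ ^ 2) t (fun i _ => hφ i) (fun v => if T v then (1 : ℝ) else 0)]
  refine Finset.sum_congr rfl fun u _ => ?_
  split_ifs <;> simp

/-- **The probability of an event on one block after the juxtaposed re-targeted circuits.** For a unitary gate set,
pairwise disjoint blocks off the prefix, and a basis input `w` with prefix content `c = w ∘ p`: the probability that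
block `t` shows an event `T` is `Σ_{u : T u} |(U_t^{A⟨c⟩} |w ∘ E t⟩)(u)|²` — the juxtaposed blocks do not disturb each
other. [cite: NielsenChuang2010, §2.2.8] [cite: BennettBernsteinBrassardVazirani1997, §4] -/
theorem sum_normSq_flatMap_retarget_block_event (hG : G.IsUnitary) (A : Language Bool) (hE : BlockDisjoint E)
    (pre : Fin m → List (QGate G N₀)) (w : QReg N) (t : Fin m) (T : QReg N₀ → Prop) [DecidablePred T] :
    (∑ z : QReg N, if T (z ∘ E t) then
        ‖((⟨(List.finRange m).flatMap fun t => retarget p (E t) (hdisj t) (pre t)⟩ : QCircuit G N).toMatrix A *ᵥ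
          basisState w) z‖ ^ 2 else 0) =
      ∑ u : QReg N₀, if T u then
        ‖((⟨pre t⟩ : QCircuit G N₀).toMatrix (prefixSlice A (List.ofFn (w ∘ p))) *ᵥ basisState (w ∘ E t)) u‖ ^ 2
        else 0 := by
  rw [toMatrix_flatMap_retarget_mulVec_basisState p E hdisj A hE pre w]
  refine sum_normSq_prodState_block_event E hE _ (fun t' => ?_) w t T
  rw [normSq_mulVec_of_mem_unitaryGroup (QCircuit.toMatrix_mem_unitaryGroup_holds hG _ _), normSq_basisState]

end Literature.Computability.QuantumComplexity

end
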